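import Summits.ResolutionOfSingularities.ResolutionOfSingularities.Theorems.EquisingularLiftEquisingularLiftNatDirectionOfChartColumns
import HarnessLib

/-!
# [OURS · L1 W4.5(b) · EL♮(3)] T-DIRLIFT-UP route C, brick C3⁺ (C3-i) — THE UPSTAIRS DIRECTION FROM A FINITE FAMILY OF CHART COLUMNS

Crux chain w45b (cell `res-hironaka`, slot W4.5(b)), child **EL♮(3)** = stmt-ResolutionOfSingularities-20148, route EquisingularLift,
S6 (L) brick C3⁺ of res-L1-w45b-stub-4 g9 (request STATUS 2026-08-27T23:05:44Z): the FINITE-FAMILY TWIN of res-L1-w45b-stub-2's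
`…NatDirectionOfChartColumns` (p566849). The (L) assembly covers `V(I) ≅ ℙ¹_O` by finitely many point-indexed conormal charts, so the
two-chart (`Fin 2`) form cannot be fed; here the chart index is any finite type `κ`, the cover hypothesis reads
`supp I ⊆ ⋃ₐ U a`, and the cocycle hypothesis is stated for every pair of charts. Statements and proofs are p566849's with
`Fin 2 ↦ κ`: `stalkIdeal_chartModel_family`, **`exists_direction_of_chartSections_family`**, **`exists_direction_of_chartColumns_family`**
(adapted quasi-regular 2-frames at every point of `supp I` via p566849's chart-local `exists_adaptedFrame_of_chartColumn`), and
**`comap_eq_of_chartSections_family`** (`𝒟·𝒪_{G₀} = 𝒟̄` stalkwise). Written by res-L1-w45b-stub-3 g7. HONEST FRAMING: OURS; NOT a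
statement of any manuscript; AI-written, weaker than expert review. No `sorry`; standard axioms; DEF-FREE.
`--supports stmt-ResolutionOfSingularities-20148 --as helper`.

References (index only): p566849 (res-L1-w45b-stub-2) and its references; res-type-089 `Lib/ReesAlgebraGlue` (gluing with prescribed
stalks, `κ`-indexed). [cite: Hartshorne1977, Ch. II Ex. 1.22] [cite: Matsumura1987, §16 Definition p. 124] (index only).
-/

set_option linter.dupNamespace false -- mandated namespace `Summit.<Summit>.<Problem>` of this single-conjunct summit

noncomputable section

open CategoryTheory CategoryTheory.Limits AlgebraicGeometry TopologicalSpace Topology IsLocalRing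
open Literature.AlgebraicGeometry.Resolution
open Literature.AlgebraicGeometry.Hironaka2017.S02Preliminaries
open AlgebraicGeometry.Scheme.IdealSheafData

namespace Summit.ResolutionOfSingularities.ResolutionOfSingularities.Cruxes.EquisingularLiftNat.Sections

universe u

/-! ## The chart models and the glued direction (finite family of charts) -/

section ChartFamily

variable {X₀ : Scheme.{u}} [IsLocallyNoetherian X₀] (I : X₀.IdealSheafData) {κ : Type} [Finite κ] (U : κ → X₀.affineOpens)
  (c : ∀ a : κ, Γ(X₀, U a))

omit [Finite κ] in
/-- **Stalks of the chart model** (family form of p566849's `stalkIdeal_chartModel`): the push-forward to `X₀` of the ideal sheaf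
`((c_a) + I(U_a)²)~` on the affine chart `U a` has stalk `(c_a)_p + I_p²` at every `p ∈ U a`. [cite: Hartshorne1977, Ch. II Prop. 5.4]
[OURS · L1 W4.5b · C3⁺] -/
theorem stalkIdeal_chartModel_family (a : κ) {p : X₀} (hp : p ∈ (U a : X₀.Opens)) :
    stalkIdeal ((Hironaka2005.idealSheafOnOpen (U a) (Ideal.span {c a} ⊔ I.ideal (U a) ^ 2)).map (U a : X₀.Opens).ι) p =
      Ideal.span {(X₀.presheaf.germ (U a) p hp).hom (c a)} ⊔ stalkIdeal I p ^ 2 := by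
  rw [stalkIdeal_map_idealSheafOnOpen (U a) _ hp, Ideal.map_sup, Ideal.map_span, Set.image_singleton, Ideal.map_pow,
    ← stalkIdeal_eq_map_germ I (U a) hp]

/-- **C3⁺ (C3-i), the glued direction from a finite family of charts.** Chart sections `c a ∈ I(U a)` on finitely many affine charts
`U a` covering `supp I`, whose chart models `(c_a) + I²` have the SAME STALKS on every overlap `U a ∩ U b` (the cocycle relation),
glue to one ideal sheaf `𝒟` on `X₀` with `I·I ≤ 𝒟 ≤ I` and `𝒟_p = (c_a)_p + I_p²` on `U a`. [cite: Hartshorne1977, Ch. II Ex. 1.22]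
[OURS · L1 W4.5b · T-DIRLIFT-UP C3⁺] toward `stub_elnat_ratDirZeroPointResolution` / `stub_elnat_coneTowerPointResolution`
(stmt-ResolutionOfSingularities-20148); NOT a statement of the manuscript. -/
theorem exists_direction_of_chartSections_family (hcov : (I.support : Set X₀) ⊆ ⋃ a, ((U a : X₀.Opens) : Set X₀))
    (hcI : ∀ a, c a ∈ I.ideal (U a))
    (hcompat : ∀ (a b : κ) (p : X₀) (ha : p ∈ (U a : X₀.Opens)) (hb : p ∈ (U b : X₀.Opens)),
      Ideal.span {(X₀.presheaf.germ (U a) p ha).hom (c a)} ⊔ stalkIdeal I p ^ 2 =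
        Ideal.span {(X₀.presheaf.germ (U b) p hb).hom (c b)} ⊔ stalkIdeal I p ^ 2) :
    ∃ 𝒟 : X₀.IdealSheafData, I * I ≤ 𝒟 ∧ 𝒟 ≤ I ∧
      ∀ (a : κ) (p : X₀) (hp : p ∈ (U a : X₀.Opens)),
        stalkIdeal 𝒟 p = Ideal.span {(X₀.presheaf.germ (U a) p hp).hom (c a)} ⊔ stalkIdeal I p ^ 2 := by
  classical
  -- the chart models, pushed forward to `X₀`
  let N : κ → X₀.IdealSheafData := fun a =>
    (Hironaka2005.idealSheafOnOpen (U a) (Ideal.span {c a} ⊔ I.ideal (U a) ^ 2)).map (U a : X₀.Opens).ι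
  have hN : ∀ (a : κ) {p : X₀} (hp : p ∈ (U a : X₀.Opens)),
      stalkIdeal (N a) p = Ideal.span {(X₀.presheaf.germ (U a) p hp).hom (c a)} ⊔ stalkIdeal I p ^ 2 :=
    fun a p hp => stalkIdeal_chartModel_family I U c a hp
  -- same stalks on the overlaps
  have hcompat' : ∀ (j k : κ), ∀ p ∈ (U j : X₀.Opens) ⊓ (U k : X₀.Opens), stalkIdeal (N j) p = stalkIdeal (N k) p := by
    intro j k p hp
    obtain ⟨hj, hk⟩ := hp
    rw [hN j hj, hN k hk]
    exact hcompat j k p hj hk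
  -- glue (res-type-089's `⨅ₐ (·|_{U a})_*` with prescribed stalks)
  obtain ⟨G, hG, hG₀⟩ := exists_idealSheafData_stalkIdeal_eq_of_compatible (fun a : κ => (U a : X₀.Opens)) N hcompat'
  -- off the charts: unit stalks (the charts cover `supp I`)
  have hoff : ∀ p : X₀, (¬ ∃ a, p ∈ (U a : X₀.Opens)) → stalkIdeal I p = ⊤ ∧ stalkIdeal G p = ⊤ := by
    intro p hnot
    have hps : p ∉ I.support := fun h => by
      obtain ⟨a, ha⟩ := Set.mem_iUnion.mp (hcov h)
      exact hnot ⟨a, ha⟩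
    refine ⟨stalkIdeal_eq_top_of_not_mem_support hps, ?_⟩
    refine hG₀ I.support.compl ?_ p hps
    intro a q hq
    obtain ⟨hqa, hqs⟩ := hq
    rw [hN a hqa, stalkIdeal_eq_top_of_not_mem_support hqs, pow_two, Ideal.top_mul]
    exact sup_top_eq _
  refine ⟨G, ?_, ?_, ?_⟩
  · -- `I·I ≤ 𝒟`
    refine le_of_forall_stalkIdeal_le fun p => ?_
    rw [stalkIdeal_mul, ← pow_two]
    by_cases h : ∃ a, p ∈ (U a : X₀.Opens)
    · obtain ⟨a, ha⟩ := h
      rw [hG a p ha, hN a ha]; exact le_sup_right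
    · rw [(hoff p h).2]; exact le_top
  · -- `𝒟 ≤ I`
    refine le_of_forall_stalkIdeal_le fun p => ?_
    have hle : ∀ (a : κ) (hp : p ∈ (U a : X₀.Opens)),
        Ideal.span {(X₀.presheaf.germ (U a) p hp).hom (c a)} ⊔ stalkIdeal I p ^ 2 ≤ stalkIdeal I p := by
      intro a hp
      refine sup_le ?_ ?_
      · rw [Ideal.span_singleton_le_iff_mem, stalkIdeal_eq_map_germ I (U a) hp]
        exact Ideal.mem_map_of_mem _ (hcI a)
      · rw [pow_two]; exact Ideal.mul_le_right
    by_cases h : ∃ a, p ∈ (U a : X₀.Opens)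
    · obtain ⟨a, ha⟩ := h
      rw [hG a p ha, hN a ha]; exact hle a ha
    · rw [(hoff p h).1]; exact le_top
  · intro a p hp
    rw [hG a p hp, hN a hp]

/-- **C3⁺ (C3-i) packaged.** A finite family of affine charts `U a ⊇ supp I` with frames `I(U a) = (ℓ_a, m_a)` quasi-regular at the points
of the curve, and LIFTED COLUMNS `(A_a, B_a)` unimodular modulo `I` (`x_a A_a + y_a B_a − 1 ∈ I(U a)`) whose directions
`(A_a ℓ_a + B_a m_a) + I²` have the same stalks on every overlap: ONE direction `𝒟` on `X₀` with `I·I ≤ 𝒟 ≤ I`, the chart stalks, and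
an adapted quasi-regular 2-frame at EVERY point of `supp I`. [cite: Hartshorne1977, Ch. II Ex. 1.22]
[cite: Matsumura1987, §16 Definition p. 124] [OURS · L1 W4.5b · T-DIRLIFT-UP C3⁺] toward `stub_elnat_ratDirZeroPointResolution` /
`stub_elnat_coneTowerPointResolution`; NOT a statement of the manuscript. -/
theorem exists_direction_of_chartColumns_family (hcov : (I.support : Set X₀) ⊆ ⋃ a, ((U a : X₀.Opens) : Set X₀))
    (ℓ m A B x y : ∀ a : κ, Γ(X₀, U a))
    (hgen : ∀ a, I.ideal (U a) = Ideal.span {ℓ a, m a})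
    (hfr : ∀ (a : κ) (p : X₀) (hp : p ∈ (U a : X₀.Opens)), p ∈ I.support →
      IsQuasiRegular ![(X₀.presheaf.germ (U a) p hp).hom (ℓ a), (X₀.presheaf.germ (U a) p hp).hom (m a)])
    (hunimod : ∀ a, x a * A a + y a * B a - 1 ∈ I.ideal (U a))
    (hcompat : ∀ (a b : κ) (p : X₀) (ha : p ∈ (U a : X₀.Opens)) (hb : p ∈ (U b : X₀.Opens)),
      Ideal.span {(X₀.presheaf.germ (U a) p ha).hom (A a * ℓ a + B a * m a)} ⊔ stalkIdeal I p ^ 2 =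
        Ideal.span {(X₀.presheaf.germ (U b) p hb).hom (A b * ℓ b + B b * m b)} ⊔ stalkIdeal I p ^ 2) :
    ∃ 𝒟 : X₀.IdealSheafData, I * I ≤ 𝒟 ∧ 𝒟 ≤ I ∧
      (∀ (a : κ) (p : X₀) (hp : p ∈ (U a : X₀.Opens)),
        stalkIdeal 𝒟 p = Ideal.span {(X₀.presheaf.germ (U a) p hp).hom (A a * ℓ a + B a * m a)} ⊔ stalkIdeal I p ^ 2) ∧
      ∀ p ∈ I.support, ∃ c' : Fin 2 → X₀.presheaf.stalk p,
        Ideal.span (Set.range c') = stalkIdeal I p ∧ IsQuasiRegular c' ∧ stalkIdeal 𝒟 p = Ideal.span {c' 0} ⊔ Ideal.span {c' 1 * c' 1} := by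
  have hcI : ∀ a, A a * ℓ a + B a * m a ∈ I.ideal (U a) := fun a => by
    rw [hgen a]
    exact Ideal.add_mem _ (Ideal.mul_mem_left _ _ (Ideal.subset_span (Set.mem_insert _ _)))
      (Ideal.mul_mem_left _ _ (Ideal.subset_span (Set.mem_insert_of_mem _ rfl)))
  obtain ⟨𝒟, hII, hI, h𝒟⟩ := exists_direction_of_chartSections_family I U (fun a => A a * ℓ a + B a * m a) hcov hcI hcompat
  refine ⟨𝒟, hII, hI, h𝒟, fun p hps => ?_⟩
  obtain ⟨a, hp⟩ : ∃ a : κ, p ∈ (U a : X₀.Opens) := Set.mem_iUnion.mp (hcov hps)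
  exact exists_adaptedFrame_of_chartColumn I (fun _ : Fin 2 => U a) 0 (ℓ a) (m a) (A a) (B a) (x a) (y a) 𝒟 (hgen a) (hunimod a) hp
    hps (hfr a p hp hps) (h𝒟 a p hp)

end ChartFamily

/-! ## The reduced direction along the special fibre (finite family of charts) -/

/-- **`𝒟·𝒪_{G₀} = 𝒟̄` from the chart stalks** (family form of p566849's `comap_eq_of_chartSections`). Along `j₀ : G₀ → X₀`, if `𝒟` has
chart stalks `(c_a)_p + I_p²` on a family of charts covering `supp I` (with `I·I ≤ 𝒟`) and `𝒟̄` has the reduced chart stalks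
`(j₀♯ c_a)_z + Ī_z²` on `j₀⁻¹ U a` with `Ī·Ī ≤ 𝒟̄` (`Ī = I·𝒪_{G₀}`), then `𝒟·𝒪_{G₀} = 𝒟̄`. [OURS · L1 W4.5b · C3⁺; stalkwise] -/
theorem comap_eq_of_chartSections_family {X₀ G₀ : Scheme.{u}} (j₀ : G₀ ⟶ X₀) (I 𝒟 : X₀.IdealSheafData)
    (𝒟' : G₀.IdealSheafData) {κ : Type} (U : κ → X₀.affineOpens) (c : ∀ a : κ, Γ(X₀, U a))
    (hcov : (I.support : Set X₀) ⊆ ⋃ a, ((U a : X₀.Opens) : Set X₀)) (hII : I * I ≤ 𝒟)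
    (h𝒟 : ∀ (a : κ) (p : X₀) (hp : p ∈ (U a : X₀.Opens)),
      stalkIdeal 𝒟 p = Ideal.span {(X₀.presheaf.germ (U a) p hp).hom (c a)} ⊔ stalkIdeal I p ^ 2)
    (hII' : I.comap j₀ * I.comap j₀ ≤ 𝒟')
    (h𝒟' : ∀ (a : κ) (z : G₀) (hz : j₀ z ∈ (U a : X₀.Opens)),
      stalkIdeal 𝒟' z = Ideal.span {(j₀.stalkMap z).hom ((X₀.presheaf.germ (U a) (j₀ z) hz).hom (c a))} ⊔
        stalkIdeal (I.comap j₀) z ^ 2) :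
    𝒟.comap j₀ = 𝒟' := by
  refine ext_of_forall_stalkIdeal_eq fun z => ?_
  rw [stalkIdeal_comap_eq_map_stalkMap]
  by_cases h : ∃ a, j₀ z ∈ (U a : X₀.Opens)
  · obtain ⟨a, ha⟩ := h
    rw [h𝒟 a _ ha, h𝒟' a z ha, Ideal.map_sup, Ideal.map_span, Set.image_singleton, Ideal.map_pow, ← stalkIdeal_comap_eq_map_stalkMap]
  · have hps : j₀ z ∉ I.support := fun h' => by
      obtain ⟨a, ha⟩ := Set.mem_iUnion.mp (hcov h')
      exact h ⟨a, ha⟩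
    have hI : stalkIdeal I (j₀ z) = ⊤ := stalkIdeal_eq_top_of_not_mem_support hps
    have h1 : stalkIdeal 𝒟 (j₀ z) = ⊤ := by
      rw [eq_top_iff]
      calc (⊤ : Ideal _) = stalkIdeal I (j₀ z) * stalkIdeal I (j₀ z) := by rw [hI, Ideal.top_mul]
        _ = stalkIdeal (I * I) (j₀ z) := (stalkIdeal_mul I I _).symm
        _ ≤ stalkIdeal 𝒟 (j₀ z) := stalkIdeal_mono hII _
    have hI' : stalkIdeal (I.comap j₀) z = ⊤ := by
      rw [stalkIdeal_comap_eq_map_stalkMap, hI, Ideal.map_top]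
    have h2 : stalkIdeal 𝒟' z = ⊤ := by
      rw [eq_top_iff]
      calc (⊤ : Ideal _) = stalkIdeal (I.comap j₀) z * stalkIdeal (I.comap j₀) z := by rw [hI', Ideal.top_mul]
        _ = stalkIdeal (I.comap j₀ * I.comap j₀) z := (stalkIdeal_mul _ _ _).symm
        _ ≤ stalkIdeal 𝒟' z := stalkIdeal_mono hII' _
    rw [h1, h2, Ideal.map_top]

end Summit.ResolutionOfSingularities.ResolutionOfSingularities.Cruxes.EquisingularLiftNat.Sections

end
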